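import Literature.NumberTheory.PAdicHodge.BdRPlusRamifiedLogEvalContinuity
import HarnessLib

/-!
# Linearity of the VALUES of the ramified `p`-adic evaluation, and boundedness of the values of integral series

Topic `Literature/NumberTheory/PAdicHodge`; namespace `Literature.NumberTheory.PAdicHodge.AinfRam`. THEOREMS ONLY (no definition, no named fact, no instance, no
`sorry`). Sequel of `BdRPlusRamifiedLogEvalContinuity` §1–§2 (linearity / integrality of the PARTIAL SUMS): the same for VALUES modulo `Fil^k` (`L` with
`L − S_M(β, y) ∈ Λ(j,k)` for `M ≫_j 0`):
* `value_add` — values add when the numerators add; `value_sub`; `value_mul_left` — `ι_𝒪(c)·L` is a value for the numerators `c·β` (`c ∈ 𝒪_D`, multiplication by the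
  bounded `ι_𝒪(c)`, `lattice_mul_of_bounded`); `value_sum` — finite sums;
* `exists_pow_mul_value_eq_of_natCast_mul` — a value of an INTEGRAL series (`β_m = m·γ_m`) is bounded: `p^r·L ∈ ι(𝔸_inf) + ξ^k B_dR⁺`;
* `value_unique_mod` restated: two values of the same data differ by `ξ^k B_dR⁺` (`value_sub_value_mem`).
Purpose: bookkeeping for the Hodge-line identity `p^c·ev(log_W) = Σ ϖⁱ(aᵢ·ev(log_{E₀}) + bᵢ·ev(log_{E₀}(Xᵖ)) + ev(hᵢ))` at one shallow point (crux K★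
`stmt-BirchSwinnertonDyer-22226`, line `kato_lever`, memo `Lines/kato-lever-K2-hne-direct-omega.md` §1, F3c). Infrastructure only: BSD / K★ are not proved by any of this.

## References
* J.-M. Fontaine, *Le corps des périodes p-adiques*, Astérisque 223 (1994), Exp. II §1.5.3–1.5.4. [FontaineAsterisque223III]
* J.-M. Fontaine, *Formes différentielles et modules de Tate…*, Invent. Math. 65 (1982), §5. [Fontaine1982FormesDifferentielles]
-/

noncomputable section

namespace Literature.NumberTheory.PAdicHodge

namespace AinfRam

open ValuativeRel Field Ideal WittVector Finset
open Literature.NumberTheory.GaloisRepresentations Literature.NumberTheory.GaloisRepresentations.IsNonarchimedeanLocalField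
open GaloisContinuity Literature.RingTheory.FormalGroups

variable {F : Type} [Field F] [ValuativeRel F] [TopologicalSpace F] [IsNonarchimedeanLocalField F]
  [CharZero F] {p : ℕ} [Fact p.Prime] [Fact (¬ IsUnit (p : integerC F))]
  [IsAdicComplete (Ideal.span {(p : integerC F)}) (integerC F)]
  {hp : valuation F p < 1} (D : EisensteinRoot F p hp) (hθ : Function.Surjective (fontaineTheta (integerC F) p))

/-- **Values add.** [cite: Fontaine1982FormesDifferentielles, §5] -/
theorem value_add {k : ℕ} (β β' : ℕ → D.Coeff) (y : AinfRam D) {L L' : BDeRhamPlus (integerC F) p}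
    (hL : ∀ j : ℕ, ∃ M₀ : ℕ, ∀ M : ℕ, M₀ ≤ M → ∃ (a : Ainf (p := p) F) (w : BDeRhamPlus (integerC F) p),
      L - (∑ m ∈ Finset.range M, qpToBdR (((m + 1 : ℕ) : ℚ_[p])⁻¹) * toBdR D hθ (coeffHom D (β (m + 1)) * y ^ (m + 1))) =
        ainfToBdR ((p : Ainf (p := p) F) ^ j * a) + xiBdR ^ k * w)
    (hL' : ∀ j : ℕ, ∃ M₀ : ℕ, ∀ M : ℕ, M₀ ≤ M → ∃ (a : Ainf (p := p) F) (w : BDeRhamPlus (integerC F) p),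
      L' - (∑ m ∈ Finset.range M, qpToBdR (((m + 1 : ℕ) : ℚ_[p])⁻¹) * toBdR D hθ (coeffHom D (β' (m + 1)) * y ^ (m + 1))) =
        ainfToBdR ((p : Ainf (p := p) F) ^ j * a) + xiBdR ^ k * w) :
    ∀ j : ℕ, ∃ M₀ : ℕ, ∀ M : ℕ, M₀ ≤ M → ∃ (a : Ainf (p := p) F) (w : BDeRhamPlus (integerC F) p),
      (L + L') - (∑ m ∈ Finset.range M, qpToBdR (((m + 1 : ℕ) : ℚ_[p])⁻¹) * toBdR D hθ (coeffHom D (β (m + 1) + β' (m + 1)) * y ^ (m + 1))) =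
        ainfToBdR ((p : Ainf (p := p) F) ^ j * a) + xiBdR ^ k * w := by
  intro j
  obtain ⟨M₀, h⟩ := hL j
  obtain ⟨M₀', h'⟩ := hL' j
  refine ⟨max M₀ M₀', fun M hM => ?_⟩
  obtain ⟨a, w, h1⟩ := h M ((le_max_left _ _).trans hM)
  obtain ⟨a', w', h2⟩ := h' M ((le_max_right _ _).trans hM)
  refine ⟨a + a', w + w', ?_⟩
  rw [partialSum_add, show L + L' - ((∑ m ∈ Finset.range M, qpToBdR (((m + 1 : ℕ) : ℚ_[p])⁻¹) * toBdR D hθ (coeffHom D (β (m + 1)) * y ^ (m + 1))) +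
      ∑ m ∈ Finset.range M, qpToBdR (((m + 1 : ℕ) : ℚ_[p])⁻¹) * toBdR D hθ (coeffHom D (β' (m + 1)) * y ^ (m + 1))) =
    (L - ∑ m ∈ Finset.range M, qpToBdR (((m + 1 : ℕ) : ℚ_[p])⁻¹) * toBdR D hθ (coeffHom D (β (m + 1)) * y ^ (m + 1))) +
    (L' - ∑ m ∈ Finset.range M, qpToBdR (((m + 1 : ℕ) : ℚ_[p])⁻¹) * toBdR D hθ (coeffHom D (β' (m + 1)) * y ^ (m + 1))) by ring]
  exact lattice_add h1 h2

/-- **`ι_𝒪(c)·L` is a value for the numerators `c·β`** (`ι_𝒪(c)` is bounded by `p^{−r}`; the threshold shifts by `r`). [cite: FontaineAsterisque223III, Exp. II §1.5.3] -/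
theorem value_mul_left {k r : ℕ}
    (hr : ∀ x : AinfRam D, ∃ (a : Ainf (p := p) F) (w : BDeRhamPlus (integerC F) p),
      (p : BDeRhamPlus (integerC F) p) ^ r * toBdR D hθ x = ainfToBdR a + xiBdR ^ k * w)
    (c : D.Coeff) (β : ℕ → D.Coeff) (y : AinfRam D) {L : BDeRhamPlus (integerC F) p}
    (hL : ∀ j : ℕ, ∃ M₀ : ℕ, ∀ M : ℕ, M₀ ≤ M → ∃ (a : Ainf (p := p) F) (w : BDeRhamPlus (integerC F) p),
      L - (∑ m ∈ Finset.range M, qpToBdR (((m + 1 : ℕ) : ℚ_[p])⁻¹) * toBdR D hθ (coeffHom D (β (m + 1)) * y ^ (m + 1))) =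
        ainfToBdR ((p : Ainf (p := p) F) ^ j * a) + xiBdR ^ k * w) :
    ∀ j : ℕ, ∃ M₀ : ℕ, ∀ M : ℕ, M₀ ≤ M → ∃ (a : Ainf (p := p) F) (w : BDeRhamPlus (integerC F) p),
      toBdR D hθ (coeffHom D c) * L -
        (∑ m ∈ Finset.range M, qpToBdR (((m + 1 : ℕ) : ℚ_[p])⁻¹) * toBdR D hθ (coeffHom D (c * β (m + 1)) * y ^ (m + 1))) =
        ainfToBdR ((p : Ainf (p := p) F) ^ j * a) + xiBdR ^ k * w := by
  intro j
  obtain ⟨M₀, h⟩ := hL (j + r)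
  refine ⟨M₀, fun M hM => ?_⟩
  obtain ⟨a, w, h1⟩ := h M hM
  obtain ⟨ac, wc, hc⟩ := hr (coeffHom D c)
  rw [partialSum_mul_left, ← mul_sub]
  exact lattice_mul_of_bounded hc h1

/-- **Finite sums of values.** [cite: Fontaine1982FormesDifferentielles, §5] -/
theorem value_sum {k : ℕ} {ι : Type*} (s : Finset ι) (β : ι → ℕ → D.Coeff) (y : AinfRam D) {L : ι → BDeRhamPlus (integerC F) p}
    (hL : ∀ i ∈ s, ∀ j : ℕ, ∃ M₀ : ℕ, ∀ M : ℕ, M₀ ≤ M → ∃ (a : Ainf (p := p) F) (w : BDeRhamPlus (integerC F) p),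
      L i - (∑ m ∈ Finset.range M, qpToBdR (((m + 1 : ℕ) : ℚ_[p])⁻¹) * toBdR D hθ (coeffHom D (β i (m + 1)) * y ^ (m + 1))) =
        ainfToBdR ((p : Ainf (p := p) F) ^ j * a) + xiBdR ^ k * w) :
    ∀ j : ℕ, ∃ M₀ : ℕ, ∀ M : ℕ, M₀ ≤ M → ∃ (a : Ainf (p := p) F) (w : BDeRhamPlus (integerC F) p),
      (∑ i ∈ s, L i) - (∑ m ∈ Finset.range M, qpToBdR (((m + 1 : ℕ) : ℚ_[p])⁻¹) * toBdR D hθ (coeffHom D (∑ i ∈ s, β i (m + 1)) * y ^ (m + 1))) =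
        ainfToBdR ((p : Ainf (p := p) F) ^ j * a) + xiBdR ^ k * w := by
  classical
  induction s using Finset.induction_on with
  | empty =>
    intro j
    refine ⟨0, fun M _ => ⟨0, 0, ?_⟩⟩
    simp
  | insert i s hi ih =>
    have h1 := hL i (Finset.mem_insert_self _ _)
    have h2 := ih fun i' hi' => hL i' (Finset.mem_insert_of_mem hi')
    have h := value_add D hθ (β i) (fun m => ∑ i' ∈ s, β i' m) y h1 h2
    simpa only [Finset.sum_insert hi] using h

/-- ★ **A value of an INTEGRAL series is bounded**: if `β_m = m·γ_m` then `p^r·L ∈ ι(𝔸_inf) + ξ^k B_dR⁺` for every value `L` (the partial sums lie in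
`ι_𝒪(A_inf(𝒪))`, bounded by `p^{−r}`). [cite: FontaineAsterisque223III, Exp. II §1.5.3] -/
theorem exists_pow_mul_value_eq_of_natCast_mul {k r : ℕ}
    (hr : ∀ x : AinfRam D, ∃ (a : Ainf (p := p) F) (w : BDeRhamPlus (integerC F) p),
      (p : BDeRhamPlus (integerC F) p) ^ r * toBdR D hθ x = ainfToBdR a + xiBdR ^ k * w)
    (γ : ℕ → D.Coeff) (y : AinfRam D) {L : BDeRhamPlus (integerC F) p}
    (hL : ∀ j : ℕ, ∃ M₀ : ℕ, ∀ M : ℕ, M₀ ≤ M → ∃ (a : Ainf (p := p) F) (w : BDeRhamPlus (integerC F) p),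
      L - (∑ m ∈ Finset.range M, qpToBdR (((m + 1 : ℕ) : ℚ_[p])⁻¹) *
        toBdR D hθ (coeffHom D (((m + 1 : ℕ) : D.Coeff) * γ (m + 1)) * y ^ (m + 1))) =
        ainfToBdR ((p : Ainf (p := p) F) ^ j * a) + xiBdR ^ k * w) :
    ∃ (a : Ainf (p := p) F) (w : BDeRhamPlus (integerC F) p), (p : BDeRhamPlus (integerC F) p) ^ r * L = ainfToBdR a + xiBdR ^ k * w := by
  obtain ⟨M₀, h⟩ := hL 0
  obtain ⟨a, w, h1⟩ := h M₀ le_rfl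
  obtain ⟨a', w', h2⟩ := exists_pow_mul_partialSum_natCast_mul_eq D hθ hr γ y M₀
  refine ⟨(p : Ainf (p := p) F) ^ r * a + a', (p : BDeRhamPlus (integerC F) p) ^ r * w + w', ?_⟩
  have e : (p : BDeRhamPlus (integerC F) p) ^ r * L = (p : BDeRhamPlus (integerC F) p) ^ r *
      (L - ∑ m ∈ Finset.range M₀, qpToBdR (((m + 1 : ℕ) : ℚ_[p])⁻¹) * toBdR D hθ (coeffHom D (((m + 1 : ℕ) : D.Coeff) * γ (m + 1)) * y ^ (m + 1))) +
      (p : BDeRhamPlus (integerC F) p) ^ r *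
        ∑ m ∈ Finset.range M₀, qpToBdR (((m + 1 : ℕ) : ℚ_[p])⁻¹) * toBdR D hθ (coeffHom D (((m + 1 : ℕ) : D.Coeff) * γ (m + 1)) * y ^ (m + 1)) := by ring
  rw [e, h1, h2]
  simp only [map_add, map_mul, map_pow, map_natCast, pow_zero, one_mul]
  ring

end AinfRam

end Literature.NumberTheory.PAdicHodge

end
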